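import Mathlib
import HarnessLib
import Summits.HubbardSuperconductivity.HubbardSuperconductivity.Theorems.KLProgrammeKLRegimeTwoVolumeSrcTowerBlock
import Summits.HubbardSuperconductivity.HubbardSuperconductivity.Theorems.KLProgrammeKLRegimeSectorSliceGramSoftSharp
import Summits.HubbardSuperconductivity.HubbardSuperconductivity.Theorems.KLProgrammeKLRegimeAlphaWtFlowAllReg
import Summits.HubbardSuperconductivity.HubbardSuperconductivity.Theorems.KLProgrammeKLRegimeOverlapWtJumpFlowAll
import Summits.HubbardSuperconductivity.HubbardSuperconductivity.Theorems.KLProgrammeKLRegimeOverlapWtColFlowAll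
import Summits.HubbardSuperconductivity.HubbardSuperconductivity.Theorems.KLProgrammeKLRegimeAlphaWtFlowDeep

/-!
# Route `KLProgramme` — crux K3, VL child `KLRegimeVolumeLimitV17F3` (stmt-HubbardSuperconductivity-23356), producer route «(VL)-SRC-SOFT» §S5c-1:
# THE BLOCK DATA OF THE SOURCE TOWER AT THE TOP FLOW FRAME — Gram, weighted rows/cols of the block covariance, weighted overlap rows and (general-jump)
# columns, for EVERY block bottom `k ≥ 1` and length `ℓ ≤ d′`, in the shape `…SrcTowerInduction.sourceProfilesAtLev_allLevels` consumes
# (seat hubbard-kl-k3c4-p1 g19; `--supports` 23356)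

Four landed suppliers, instantiated at the source geometry (fat `F̃_k`, slice `(Λ_{k+1+ℓ}, Λ_{k+1}]`, thin `F_{k+ℓ}`, rate `k+ℓ`) on the top frame
`K = klFlowFrameU L M β U μ (n_β + 1)`:
* Gram — `gram_sliceCT_bgmFat_sharp_klEng` (fat level `m + 1 = k ≥ 1`, `Λ′ = Λ_{k+1}`; `FrameOK` from `frameOK_klFlowFrameU_of_histP_le`), put in the binder form
  `κ²·8^{k+1} = 2Cκe₀` by E1's `towerDict_sigma`;
* rows/cols `α = Cb(M/β)/Λ_{k+1+ℓ}` — `alphaWt_blockSliceCT_bgmFat_klEng_flow_all' (d′)` (`nf = k`, `J₂ = k+1+ℓ ≤ nf+1+d′`, `J′ = k+ℓ`);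
* overlap rows `cr = 81·CJ·M/β` — `overlapWt_jump_sums_klEng_flow_all` (`J′ = k+ℓ`); overlap columns `cc = 81·2^ℓ·CJ′·M/β` — hubbard-kl-p1 g23's
  `overlapWt_colSum_klEng_flow_all` («(VL)-SRC-COLS», `jw = J′ = k+ℓ`, exponent `J′ − k = ℓ`).
The last three take the (K5′) clauses `∀ m, 1 ≤ m → m < n_β+1 → FlowPieceOscAt L M c″ β U μ m` (the engine's (C)-lane export, an ATOM of the producer — memo
SRC-SOFT-g19 §7(c)); `IsKLRegime` is `isKLRegime_of_le_nScales_succ`.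

* **`srcTower_blockData (d′) (R) (c″)`** — `∃ Cκ Cb CJ CJ′ > 0` (depending on `d′, R, c″` only) such that under the stub binders + `HistP … 0 (n_β+1)` + (K5′), for
  every `1 ≤ k`, `1 ≤ ℓ ≤ d′`, `k + ℓ ≤ n_β`: the data conjunction of `sourceProfilesAtLev_allLevels`' `hdata`.
Composition of landed theorems; nothing about the model is asserted beyond them; nothing asserts any stub, VL, K3 or superconductivity.
References: BGM 2006 §2.7 (2.70)–(2.71a), §2.8 (2.77)–(2.83), §3 (3.2)–(3.8) [cite: BenfattoGiulianiMastropietro2006].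
-/

noncomputable section

namespace Summit.HubbardSuperconductivity.HubbardSuperconductivity.Theorems.TwoVolumeDefect

set_option linter.dupNamespace false -- summit = problem name (single-conjunct summit), D-0017

open Real Finset Literature.MathematicalPhysics.QuantumLattice GrassmannAlgebra Literature.Probability.LatticeModels
open Literature.Probability.LatticeModels.BattleFederbush
open Summit.HubbardSuperconductivity.HubbardSuperconductivity.Theorems.KLProgrammeLegKernels
open Summit.HubbardSuperconductivity.HubbardSuperconductivity.Theorems.KLRegimeSplit
open Summit.HubbardSuperconductivity.HubbardSuperconductivity.Theorems.EngineV8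
open Summit.HubbardSuperconductivity.HubbardSuperconductivity.Theorems.TwoVolumeSource
open Summit.HubbardSuperconductivity.HubbardSuperconductivity.Theorems.TorusFourierL2
open Summit.HubbardSuperconductivity.HubbardSuperconductivity.Theorems.DispersionFlow

/-- **THE BLOCK DATA OF THE SOURCE TOWER AT THE TOP FLOW FRAME** (see the module docstring).
[cite: BenfattoGiulianiMastropietro2006, §2.7 (2.70)-(2.71a), §2.8 (2.77)-(2.83), §3 (3.2)-(3.8)] -/
theorem srcTower_blockData (d' : ℕ) (R : RenConsts) (c'' : ℝ) (hc'' : 0 < c'') :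
    ∃ Cκ Cb CJ CJ' : ℝ, 0 < Cκ ∧ 0 < Cb ∧ 0 < CJ ∧ 0 < CJ' ∧
      ∀ (G : GeoConsts) (P : SplitConsts) (Q : EngConsts) (c : ℝ), P.WF → R.WF2 → 0 < c → c ≤ klEngC₃6 P R →
      ∀ μ ∈ klWindowC, ∀ U : ℝ, 0 < U → U ≤ min (klEngU₀3 P R c) (1 / (R.Gfr 3 + 1)) → U ≤ klEngU₀4 P R c → c'' * U ≤ 1 →
      ∀ β : ℝ, klBetaMin ≤ β → β ≤ Real.exp (c / U ^ 2) →
      ∀ (L M : ℕ) [NeZero L] [NeZero M], klEngL₃ β U ≤ L → klEngM₃ β U L ≤ M →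
      HistP klPredsV17F2 L M G P Q R β U μ 0 (nScales β + 1) → (∀ m, 1 ≤ m → m < nScales β + 1 → FlowPieceOscAt L M c'' β U μ m) →
      ∀ k ℓ : ℕ, 1 ≤ k → 1 ≤ ℓ → ℓ ≤ d' → k + ℓ ≤ nScales β → ∃ κ α cr cc : ℝ, 0 < κ ∧ κ ^ 2 * (8 : ℝ) ^ (k + 1) = 2 * Cκ * klE0 ∧
        α = Cb * ((M : ℝ) / β) / klScale klE0 (k + 1 + ℓ) ∧ cr = 81 * CJ * M / β ∧ cc = 81 * (2 : ℝ) ^ ℓ * CJ' * M / β ∧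
        IsGramBoundedR ((sectorSubMatrix L M β (bgmFatMultiplier L M klE0 β (nambuXiCT L μ (klFlowFrameU L M β U μ (nScales β + 1))) k)).transpose *
          hubbardCovSliceCT L M β μ 0 (klFlowFrameU L M β U μ (nScales β + 1)) (klScale klE0 (k + 1 + ℓ)) (klScale klE0 (k + 1)) *
            sectorSubMatrix L M β (bgmFatMultiplier L M klE0 β (nambuXiCT L μ (klFlowFrameU L M β U μ (nScales β + 1))) k)) κ ∧
        (∀ X, ∑ Y, ‖((sectorSubMatrix L M β (bgmFatMultiplier L M klE0 β (nambuXiCT L μ (klFlowFrameU L M β U μ (nScales β + 1))) k)).transpose *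
          hubbardCovSliceCT L M β μ 0 (klFlowFrameU L M β U μ (nScales β + 1)) (klScale klE0 (k + 1 + ℓ)) (klScale klE0 (k + 1)) *
            sectorSubMatrix L M β (bgmFatMultiplier L M klE0 β (nambuXiCT L μ (klFlowFrameU L M β U μ (nScales β + 1))) k)) X Y‖ *
          klScaleWt L M β (k + ℓ) {latticeLegPos (2 * (2 * M)) X, latticeLegPos (2 * (2 * M)) Y} ≤ α) ∧
        (∀ Y, ∑ X, ‖((sectorSubMatrix L M β (bgmFatMultiplier L M klE0 β (nambuXiCT L μ (klFlowFrameU L M β U μ (nScales β + 1))) k)).transpose *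
          hubbardCovSliceCT L M β μ 0 (klFlowFrameU L M β U μ (nScales β + 1)) (klScale klE0 (k + 1 + ℓ)) (klScale klE0 (k + 1)) *
            sectorSubMatrix L M β (bgmFatMultiplier L M klE0 β (nambuXiCT L μ (klFlowFrameU L M β U μ (nScales β + 1))) k)) X Y‖ *
          klScaleWt L M β (k + ℓ) {latticeLegPos (2 * (2 * M)) X, latticeLegPos (2 * (2 * M)) Y} ≤ α) ∧
        (∀ X'', ∑ X', ‖(sectorAnalysisMatrix L M β (klAnisoFamily L M β μ (klFlowFrameU L M β U μ (nScales β + 1)) klE0 (k + ℓ)) *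
          sectorSubMatrix L M β (bgmFatMultiplier L M klE0 β (nambuXiCT L μ (klFlowFrameU L M β U μ (nScales β + 1))) k)) X'' X'‖ *
          klScaleWt L M β (k + ℓ) {latticeLegPos (2 * (2 * M)) X'', latticeLegPos (2 * (2 * M)) X'} ≤ cr) ∧
        (∀ X', ∑ X'', ‖(sectorAnalysisMatrix L M β (klAnisoFamily L M β μ (klFlowFrameU L M β U μ (nScales β + 1)) klE0 (k + ℓ)) *
          sectorSubMatrix L M β (bgmFatMultiplier L M klE0 β (nambuXiCT L μ (klFlowFrameU L M β U μ (nScales β + 1))) k)) X'' X'‖ *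
          klScaleWt L M β (k + ℓ) {latticeLegPos (2 * (2 * M)) X'', latticeLegPos (2 * (2 * M)) X'} ≤ cc) := by
  obtain ⟨Cκ, hCκ, hgram⟩ := gram_sliceCT_bgmFat_sharp_klEng
  obtain ⟨Cb, hCb, halpha⟩ := alphaWt_blockSliceCT_bgmFat_klEng_flow_all' d' R c'' hc''
  obtain ⟨CJ, hCJ, hrows⟩ := overlapWt_jump_sums_klEng_flow_all R c'' hc''.le
  obtain ⟨CJ', hCJ', hcols⟩ := overlapWt_colSum_klEng_flow_all R c'' hc''.le
  refine ⟨Cκ, Cb, CJ, CJ', hCκ, hCb, hCJ, hCJ', ?_⟩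
  intro G P Q c hP hR2 hc hc6 μ hμ U hU hU3 hU4 hcU β hβmin hβc L M _ _ hL3 hM3 hhist hosc k ℓ hk hℓ hℓd hkℓ
  have he : (0 : ℝ) < klE0 := by norm_num [klE0]
  have hn1 : 1 ≤ nScales β + 1 := Nat.le_add_left 1 _
  have hreg : IsKLRegime U c (-((nScales β + 1 : ℕ) : ℤ)) := isKLRegime_of_le_nScales_succ hc.le hβmin hβc le_rfl
  have hfr : FrameOK R U (nScales β) μ (klFlowFrameU L M β U μ (nScales β + 1)) := frameOK_klFlowFrameU_of_histP_le hR2 hn1 le_rfl le_rfl hhist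
  -- Gram (fat level `k = (k-1)+1`, slice `(Λ_{k+1+ℓ}, Λ_{k+1}]`)
  obtain ⟨j, rfl⟩ : ∃ j, k = j + 1 := ⟨k - 1, by omega⟩
  have hG := (hgram P R c hP hR2 hc (hc6.trans (klEngC₃6_le_klEngC₃3 P R)) μ hμ U hU hU4 β hβmin hβc _ hfr L M hL3 hM3 j (by omega)
    (klScale klE0 (j + 1 + 1 + ℓ)) (klScale klE0 (j + 1 + 1)) (klth_klScale_pos _) (klScale_le_klScale he.le (by omega))
    (klScale_le_klScale he.le (by omega))).2.1
  set κ : ℝ := Real.sqrt (Cκ * (klScale klE0 (j + 1 + 1) / klScale klE0 (j + 1)) * (klE0 * ((8 : ℝ) ^ (j + 1))⁻¹)) with hκdef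
  have hκpos : 0 < κ := by
    have h1 := klth_klScale_pos (j + 1 + 1); have h2 := klth_klScale_pos (j + 1)
    exact Real.sqrt_pos.2 (by positivity)
  have hσ8 : κ ^ 2 * (8 : ℝ) ^ (j + 1 + 1) = 2 * Cκ * klE0 :=
    towerDict_sigma hCκ.le (m := j + 1 + 1) (by omega) (by rw [Nat.add_sub_cancel])
  -- rows/cols of the block covariance
  have hA := halpha G P Q c hR2 hc hc6 μ hμ U hU hU3 hcU β hβmin hβc L M hL3 hM3 (nScales β + 1) hn1 le_rfl hreg hhist hosc (j + 1) (by omega)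
    (j + 1 + 1 + ℓ) (by omega) (by omega) (by omega) (j + 1 + ℓ) (by omega)
  -- overlap rows and columns of the jump `k → k + ℓ`
  have hRw := (hrows G P Q c hR2 hc hc6 μ hμ U hU hU3 hcU β hβmin hβc L M hL3 hM3 (nScales β + 1) hn1 le_rfl hreg hhist hosc (j + 1) (j + 1 + ℓ)
    (by omega) (by omega)).1
  have hCl := hcols G P Q c hR2 hc hc6 μ hμ U hU hU3 hcU β hβmin hβc L M hL3 hM3 (nScales β + 1) hn1 le_rfl hreg hhist hosc (j + 1) (j + 1 + ℓ)
    (by omega) (by omega) (j + 1 + ℓ) le_rfl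
  rw [show j + 1 + ℓ - (j + 1) = ℓ by omega] at hCl
  exact ⟨κ, Cb * ((M : ℝ) / β) / klScale klE0 (j + 1 + 1 + ℓ), 81 * CJ * M / β, 81 * (2 : ℝ) ^ ℓ * CJ' * M / β, hκpos, hσ8, rfl, rfl, rfl,
    hG, hA.1, hA.2, hRw, hCl⟩

end Summit.HubbardSuperconductivity.HubbardSuperconductivity.Theorems.TwoVolumeDefect

end
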